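import Literature.NumberTheory.Automorphic.DualGroupIsSplitProofs
import HarnessLib

/-!
# The Buzzard–Gee element `(2ρ)(-1)` is central: discharge of `cGroupElt_mem_center`
(trunk T-AUTOMORPHIC, G25 AutomorphicL; proof file of the named fact of `DualGroup.lean`)

`DualGroup.lean` vendors, for a dual group structure `D : L.DualGroupStr P b` on an L-group datum
over `ℂ` (item I3), the named fact
`LGroupData.DualGroupStr.cGroupElt_mem_center D : D.cGroupElt ∈ Subgroup.center ↥L.dual` — the
element `ε = (2ρ)(-1) ∈ T̂` (the cocharacter `2ρ = ∑_{α > 0} α ∈ X = X_*(T̂)` of the dual torus,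
evaluated at `-1`) is central in `Ĝ = L.dual` (Buzzard–Gee, *The conjectural connections between
automorphic representations and Galois representations*, §5.3, Proposition 5.3.3: "The element
`e` is a central element of `Ĝ` and is independent of all choices"). This file proves it, by the
standard argument recorded in the docstring of the fact:

1. **`⟨2ρ, α^∨⟩ ∈ 2ℤ` for every coroot `α^∨`** (`RootPairing.Base.even_toLinearMap_twoRho_coroot`;
   Bourbaki, *Lie* VI §1.10, Prop. 29 gives `⟨2ρ, α_i^∨⟩ = 2` for simple coroots in the reduced
   case). The proof given here is elementary and needs no reducedness hypothesis on `P`: for a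
   simple root `α_j`, the simple reflection `s_j` is an involution of the index set with
   `⟨s_j β, α_j^∨⟩ = -⟨β, α_j^∨⟩`, so the positive roots `β` with `s_j β` positive contribute `0`
   to `∑_{β > 0} ⟨β, α_j^∨⟩`, while a positive root `β` with `s_j β` negative is an integer
   multiple `f • α_j` of `α_j` (sign dichotomy of the coefficients of a root over a base, Mathlib
   `RootPairing.Base.pos_or_neg_of_sum_smul_root_mem`), contributing `2f`; a general coroot is an
   integer combination of simple coroots (`b.flip`).
2. Hence every root `α̂` of `(Ĝ, T̂)` — these are the characters `χ_{α^∨}` of the coroots of `P`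
   (`IsRootDatumOf.range_root` for `D.isBased`) — satisfies `α̂(ε) = (-1)^{⟨2ρ, α^∨⟩} = 1`
   (`IsRootDatumOf.charOfWeight_cocharOfCoweight`, i.e. `χ_x(λ_y(s)) = s^{⟨x, y⟩}`, Springer
   3.2.11 (i), proved in the tree as `charPairingInt_spec_holds`): `root_apply_twoRhoCochar_neg_one`.
3. `ε ∈ T̂` commutes with the commutative group `T̂` and with every root subgroup `U_α̂`
   (`rootSubgroup_le_centralizer_of_apply_eq_one`), hence with the group they generate, which is
   `Ĝ` (Springer 8.1.1 (ii); for the complex dual group this is a theorem of the tree, assembled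
   exactly as in `IsSplitDual.isSplit_holds` of `DualGroupIsSplitProofs.lean` from
   `torus_sup_rootSubgroups_eq_of_lieWeights_subset`, `lieWeights_subset_roots`,
   `finrank_lieWeightSpace_le_one_of_mem_roots` and `lieWeightSpace_one_le_lieAlgebraGL_of_charZero`):
   `torus_sup_rootSubgroups_eq_dual`. This is the second half of the printed proof of Springer
   8.1.8 (i) (`mem_center_iff_forall_roots_of` in `IsomorphismTheoremUnique.lean`), which we
   re-run here because only the generation input (and not `Z_Ĝ(T̂) = T̂`) is needed for this
   direction.

Main result: **`LGroupData.DualGroupStr.cGroupElt_mem_center_holds D : D.cGroupElt_mem_center`**.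
No new definitions, no new named facts.

## References

* K. Buzzard, T. Gee, *The conjectural connections between automorphic representations and Galois
  representations*, in *Automorphic forms and Galois representations* 1, LMS Lecture Note Ser. 414
  (2014), §5.3, Prop. 5.3.3 [BuzzardGee2014] (arXiv:1009.0785, p. 24 of the arXiv text).
* N. Bourbaki, *Groupes et algèbres de Lie*, Ch. VI, §1.10, Prop. 29.
* T. A. Springer, *Linear Algebraic Groups*, 2nd ed. (1998), 3.2.11 (i), 8.1.1 (ii), 8.1.8 (i)
  [SpringerLAG1998].
-/

noncomputable section

open Field
open scoped IsMulCommutative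

/-! ### Parity of `⟨2ρ, α^∨⟩` for a based root pairing over `ℤ` -/

namespace RootPairing.Base

variable {ι X Y : Type*} [AddCommGroup X] [AddCommGroup Y] {P : RootPairing ι ℤ X Y} (b : P.Base)

/-- **A positive root made negative by a simple reflection `s_j` pairs evenly with `α_j^∨`.** If
`β = α_l` is `b`-positive and `s_j β` is not, write `β = ∑ f_m α_m` with `f ≥ 0` over the simple
roots; the coefficients of the root `s_j β = β - ⟨β, α_j^∨⟩ α_j` are `f` off `j`, and by the sign
dichotomy (Mathlib `RootPairing.Base.pos_or_neg_of_sum_smul_root_mem`) they are all `≤ 0`, so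
`β = f_j α_j` and `⟨β, α_j^∨⟩ = 2 f_j` (Bourbaki, *Lie* VI §1.6, Cor. 1 of Prop. 17, in the form
valid for Mathlib's notion of base; deliberate dot-notation extension of Mathlib's
`RootPairing.Base`). [folklore] -/
theorem even_pairing_of_isPos_of_not_isPos_reflectionPerm {l j : ι} (hj : j ∈ b.support)
    (hl : b.IsPos l) (hσ : ¬ b.IsPos (P.reflectionPerm j l)) : Even (P.pairing l j) := by
  classical
  obtain ⟨f, hf₀, hsgn, hf⟩ := b.exists_root_eq_sum_int l
  have hfnn : 0 ≤ f := by
    rcases hsgn with h | h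
    · exact h.le
    · exfalso
      have h1 : b.height l ≤ 0 := by
        rw [height_eq_sum hf]
        exact Finset.sum_nonpos fun m _ => h.le m
      rw [isPos_iff] at hl
      omega
  -- the coefficients of `s_j (α_l) = α_l - ⟨α_l, α_j^∨⟩ α_j` over the simple roots
  set g : ι → ℤ := fun m => f m - if m = j then P.pairing l j else 0 with hg_def
  have hg : P.root (P.reflectionPerm j l) = ∑ m ∈ b.support, g m • P.root m := by
    rw [root_reflectionPerm, reflection_apply_root, hf]
    simp only [hg_def, sub_smul, Finset.sum_sub_distrib, ite_smul, zero_smul,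
      Finset.sum_ite_eq', if_pos hj]
  have hg₀ : g.support ⊆ b.support := by
    intro m hm
    by_cases hmj : m = j
    · exact hmj ▸ hj
    · apply hf₀
      simpa [hg_def, hmj] using hm
  rcases b.pos_or_neg_of_sum_smul_root_mem g (hg ▸ ⟨_, rfl⟩) hg₀ with hpos | hneg
  · exfalso
    apply hσ
    rw [isPos_iff', height_eq_sum hg]
    exact Finset.sum_nonneg fun m _ => hpos.le m
  · have hfm : ∀ m, m ≠ j → f m = 0 := fun m hm =>
      le_antisymm (by simpa [hg_def, hm] using hneg.le m) (hfnn m)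
    have hroot : P.root l = f j • P.root j := by
      rw [hf, Finset.sum_eq_single j (fun m _ hm => by rw [hfm m hm, zero_smul])
        (fun h => absurd hj h)]
    refine ⟨f j, ?_⟩
    rw [← root_coroot_eq_pairing, hroot, map_smul, LinearMap.smul_apply, root_coroot_eq_pairing,
      pairing_same, smul_eq_mul]
    ring

/-- **`∑_{β > 0} ⟨β, α_j^∨⟩` is even for a simple root `α_j`.** Split the `b`-positive roots `β`
according to whether `s_j β` is again positive: on that part `s_j` is an involution with
`⟨s_j β, α_j^∨⟩ = -⟨β, α_j^∨⟩`, so the partial sum vanishes; each remaining term is even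
(`even_pairing_of_isPos_of_not_isPos_reflectionPerm`). (In the reduced case the remaining part is
`{α_j}` and the sum is `⟨2ρ, α_j^∨⟩ = 2`, Bourbaki, *Lie* VI §1.10, Prop. 29.) The finite set of
positive roots is passed as any `S` with the stated membership, to be independent of decidability
instances. [folklore] -/
theorem even_sum_pairing_of_mem_support (S : Finset ι) (hS : ∀ l, l ∈ S ↔ b.IsPos l) {j : ι}
    (hj : j ∈ b.support) : Even (∑ l ∈ S, P.pairing l j) := by
  classical
  set σ : ι ≃ ι := P.reflectionPerm j with hσ
  have hσσ : ∀ l, σ (σ l) = l := fun l => P.reflectionPerm_self j l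
  have hpair : ∀ l, P.pairing (σ l) j = -P.pairing l j := fun l => by
    rw [hσ, ← P.pairing_reflectionPerm, P.pairing_reflectionPerm_self_right]
  rw [← Finset.sum_filter_add_sum_filter_not S (fun l => σ l ∈ S)]
  refine Even.add ?_ (Finset.even_sum _ fun l hl => ?_)
  · -- the `s_j`-stable part sums to zero
    set S₁ := S.filter (fun l => σ l ∈ S) with hS₁
    have hmem : ∀ l ∈ S₁, σ l ∈ S₁ := fun l hl => by
      obtain ⟨hlS, hσl⟩ := Finset.mem_filter.mp hl
      exact Finset.mem_filter.mpr ⟨hσl, by rwa [hσσ]⟩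
    have hsum : ∑ l ∈ S₁, P.pairing l j = ∑ l ∈ S₁, P.pairing (σ l) j :=
      Finset.sum_nbij' (fun l => σ l) (fun l => σ l) hmem hmem (fun l _ => hσσ l)
        (fun l _ => hσσ l) (fun l _ => by rw [hσσ])
    simp only [hpair, Finset.sum_neg_distrib] at hsum
    have h0 : ∑ l ∈ S₁, P.pairing l j = 0 := by omega
    rw [h0]
    exact Even.zero
  · obtain ⟨hlS, hσl⟩ := Finset.mem_filter.mp hl
    exact b.even_pairing_of_isPos_of_not_isPos_reflectionPerm hj ((hS l).mp hlS)
      (fun h => hσl ((hS _).mpr h))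

/-- **`⟨2ρ, α^∨⟩ ∈ 2ℤ` for every coroot `α^∨`** of a finite based root pairing over `ℤ`, where
`2ρ = ∑_{β > 0} β` (`RootPairing.Base.twoRho`, `DualGroup.lean`): for simple coroots by
`even_sum_pairing_of_mem_support`, in general because every coroot is an integer combination of
the simple coroots (`b.flip`, Mathlib `RootPairing.Base.exists_root_eq_sum_int`). This is the
root-datum input of Buzzard–Gee 2014, Prop. 5.3.3 (centrality of `(2ρ)(-1)`); cf. Bourbaki,
*Lie* VI §1.10, Prop. 29 (`⟨ρ, α_i^∨⟩ = 1`). [cite: BuzzardGee2014, §5.3, Prop. 5.3.3] -/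
theorem even_toLinearMap_twoRho_coroot [Fintype ι] (i : ι) :
    Even (P.toLinearMap b.twoRho (P.coroot i)) := by
  classical
  have hsimple : ∀ j ∈ b.support, Even (P.toLinearMap b.twoRho (P.coroot j)) := by
    intro j hj
    simp only [twoRho, map_sum, LinearMap.sum_apply, root_coroot_eq_pairing]
    exact b.even_sum_pairing_of_mem_support _ (fun l => by simp) hj
  obtain ⟨f, -, -, hf⟩ := b.flip.exists_root_eq_sum_int i
  simp only [flip_support, RootPairing.flip_root] at hf
  rw [hf, map_sum]
  exact Finset.even_sum _ fun j hj => by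
    rw [map_smul, smul_eq_mul]
    exact (hsimple j hj).mul_left (f j)

end RootPairing.Base

/-! ### Centrality of `ε = (2ρ)(-1)` in the complex dual group -/

namespace Literature.NumberTheory.Automorphic.LGroupData.DualGroupStr

variable {F : Type*} [Field F]
variable {ι X Y : Type*} [AddCommGroup X] [AddCommGroup Y]
variable {L : LGroupData F} {P : RootPairing ι ℤ X Y} {b : P.Base}
variable (D : L.DualGroupStr P b)

/-- **`T̂` and the root subgroups generate `Ĝ`** (Springer 8.1.1 (ii) for the complex dual group):
the named fact `torus_sup_rootSubgroups_eq` of `IsomorphismTheoremUnique.lean` holds for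
`(Ĝ, T̂) = (L.dual, D.torus)`, by the Lie-algebra route of `IsomorphismTheoremUniqueLie.lean`
(`torus_sup_rootSubgroups_eq_of_lieWeights_subset` with `lieWeights_subset_roots`,
`finrank_lieWeightSpace_le_one_of_mem_roots`, `lieWeightSpace_one_le_lieAlgebraGL_of_charZero`),
verbatim as inside `IsSplitDual.isSplit_holds` (`DualGroupIsSplitProofs.lean`).
[cite: SpringerLAG1998, Prop. 8.1.1 (ii)] -/
theorem torus_sup_rootSubgroups_eq_dual :
    torus_sup_rootSubgroups_eq (G := L.dual) (T := D.torus) := by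
  intro _ hG hT
  exact torus_sup_rootSubgroups_eq_of_lieWeights_subset hG.1 hT.2.1 hT.1
    (lieWeights_subset_roots hG.2.1 hT.2.1.1 hT.1)
    (fun α hα => D.finrank_lieWeightSpace_le_one_of_mem_roots hα)
    (lieWeightSpace_one_le_lieAlgebraGL_of_charZero hG hT)

/-- `Ĝ = T̂ ⊔ ⨆_{α̂ ∈ R(Ĝ, T̂)} U_α̂`, the unconditional form of `torus_sup_rootSubgroups_eq_dual`
(`Ĝ` is connected reductive and `T̂` a maximal torus by the fields of `D`; `ℂ` is algebraically
closed). [cite: SpringerLAG1998, Prop. 8.1.1 (ii)] -/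
theorem torus_sup_iSup_rootSubgroup_eq_dual :
    D.torus ⊔ ⨆ α ∈ roots L.dual D.torus, rootSubgroup L.dual D.torus (α : ↥D.torus →* ℂˣ) =
      L.dual :=
  D.torus_sup_rootSubgroups_eq_dual D.isConnectedReductive D.isMaximalTorus

variable [Fintype ι]

/-- **Every root of `(Ĝ, T̂)` kills `ε = (2ρ)(-1)`**: a root `α̂` of `(Ĝ, T̂)` is the character
`χ_{α^∨}` of a coroot `α^∨ = P.coroot i` of `P` (`IsRootDatumOf.range_root` for `D.isBased`), and
`χ_{α^∨}((2ρ)(-1)) = (-1)^{⟨2ρ, α^∨⟩} = 1` since `⟨2ρ, α^∨⟩` is even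
(`RootPairing.Base.even_toLinearMap_twoRho_coroot`) — Buzzard–Gee 2014, Prop. 5.3.3 (proof of
centrality of `e = χ(-1)`, `χ` the sum of the positive roots). [cite: BuzzardGee2014, §5.3, Prop. 5.3.3] -/
theorem root_apply_twoRhoCochar_neg_one {α : ↥(characterLattice D.torus)}
    (hα : α ∈ roots L.dual D.torus) : (α : ↥D.torus →* ℂˣ) (D.twoRhoCochar (-1)) = 1 := by
  have hmem : D.eX (Additive.ofMul α) ∈ Set.range P.flip.root := by
    rw [D.isBased.isRootDatumOf.range_root]
    exact ⟨α, hα, rfl⟩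
  obtain ⟨i, hi⟩ := hmem
  have hci : charOfWeight D.eX (P.flip.root i) = (α : ↥D.torus →* ℂˣ) := by
    rw [hi, D.charOfWeight_eX_apply α]
  rw [← hci, twoRhoCochar, D.isBased.isRootDatumOf.charOfWeight_cocharOfCoweight]
  have heven : Even (P.flip.toLinearMap (P.flip.root i) b.twoRho) := by
    simpa only [RootPairing.flip_toLinearMap, RootPairing.flip_root, LinearMap.flip_apply] using
      b.even_toLinearMap_twoRho_coroot i
  exact heven.neg_one_zpow

/-- `ε = (2ρ)(-1)`, as a matrix, lies in `T̂`. [folklore] -/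
lemma coe_cGroupElt_mem_torus : ((D.cGroupElt : ↥L.dual) : GL (Fin L.rank) ℂ) ∈ D.torus :=
  (D.twoRhoCochar (-1)).2

/-- **`cGroupElt_mem_center` holds**: the Buzzard–Gee element `ε = (2ρ)(-1)` is central in
`Ĝ = L.dual` (Buzzard–Gee 2014, §5.3, Prop. 5.3.3: "The element `e` is a central element of
`Ĝ`"). Proof: `ε ∈ T̂` commutes with the commutative group `T̂` and, being killed by every root
of `(Ĝ, T̂)` (`root_apply_twoRhoCochar_neg_one`), with every root subgroup `U_α̂`
(`rootSubgroup_le_centralizer_of_apply_eq_one`); these generate `Ĝ`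
(`torus_sup_iSup_rootSubgroup_eq_dual`, Springer 8.1.1 (ii)), as in the proof of Springer
8.1.8 (i). Discharge of the named fact of `DualGroup.lean` (D-0014).
[cite: BuzzardGee2014, §5.3, Prop. 5.3.3] -/
theorem cGroupElt_mem_center_holds : D.cGroupElt_mem_center := by
  have hεT : ((D.cGroupElt : ↥L.dual) : GL (Fin L.rank) ℂ) ∈ D.torus := D.coe_cGroupElt_mem_torus
  have hroots : ∀ α ∈ roots L.dual D.torus,
      (α : ↥D.torus →* ℂˣ) ⟨((D.cGroupElt : ↥L.dual) : GL (Fin L.rank) ℂ), hεT⟩ = 1 :=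
    fun α hα => D.root_apply_twoRhoCochar_neg_one hα
  have hle : D.torus ⊔ ⨆ α ∈ roots L.dual D.torus, rootSubgroup L.dual D.torus (α : ↥D.torus →* ℂˣ) ≤
      Subgroup.centralizer {((D.cGroupElt : ↥L.dual) : GL (Fin L.rank) ℂ)} := by
    refine sup_le (fun t ht => ?_) (iSup₂_le fun α hα =>
      rootSubgroup_le_centralizer_of_apply_eq_one hεT (hroots α hα))
    rw [Subgroup.mem_centralizer_iff]
    intro m hm
    rw [Set.mem_singleton_iff.mp hm]
    have hc := D.isMaximalTorus.2.1.2.1.is_comm.comm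
      (⟨((D.cGroupElt : ↥L.dual) : GL (Fin L.rank) ℂ), hεT⟩ : ↥D.torus) ⟨t, ht⟩
    exact congrArg Subtype.val hc
  rw [cGroupElt_mem_center, Subgroup.mem_center_iff]
  intro g
  have hg : (g : GL (Fin L.rank) ℂ) ∈
      D.torus ⊔ ⨆ α ∈ roots L.dual D.torus, rootSubgroup L.dual D.torus (α : ↥D.torus →* ℂˣ) := by
    rw [D.torus_sup_iSup_rootSubgroup_eq_dual]
    exact g.2
  have hh := hle hg
  rw [Subgroup.mem_centralizer_iff] at hh
  exact Subtype.ext (hh _ rfl).symm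

end Literature.NumberTheory.Automorphic.LGroupData.DualGroupStr
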